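import Summits.BirchSwinnertonDyer.BirchSwinnertonDyer.Theorems.Rank1ResidualX1Isogeny
import Literature.NumberTheory.EllipticCurves.ShaPrimaryIsogenyProofs
import HarnessLib

/-!
# The `phisel3` READING in the kernel: `BSD(W₀, p)` (and `BSD(Ê, p)`) from the first-descent datum
# `Ш(W₀)[φ] = 0` and a second `φ`-descent certificate "no non-trivial class of `Ш(Ê)[φ̂]` lies in
# `φ(Ш(W₀))`" — Cassels–Tate-free (cell `b2b-bsdres`, CLASS-CLOSURE instrument builder 4 =
# seat cc-eng-4, GEN 103; instrument B-24 implementation 2 `phisel3`)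

HONEST FRAMING (cell `b2b-bsdres`, run/shared/lean/b2b/bsd-rank1-residual/, verbatim in every
file): the goal of the cell is to DELETE the COMBINATION-SHAPED residual classes of the
Birch–Swinnerton-Dyer formula for ALL analytic-rank `≤ 1` elliptic curves over `ℚ` — "full BSD
formula for every rank `≤ 1` curve in class `C`" assembled STRICTLY from published theorems — so
that the rank-`≤ 1` remainder becomes exactly the CONSTRUCTION-SHAPED classes, which are TYPED
(missing-input `Prop`s), NOT attempted. This is not "finishing BSD". THIS FILE is a class-free
per-pair certificate CONSUMER (finite-abelian-group algebra on the tree's `Ш` and `Ш(φ)`, then the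
tree's Gross–Zagier–Kolyvagin and Cassels consumers); THEOREMS ONLY (no definition, no named fact,
no `sorry`); it asserts nothing about any particular curve, closes no item, books nothing, moves no
RESIDUAL-MAP mark; an instrument verdict instantiating its hypotheses is EVIDENCE (census-lead's
tier), never a Literature fact.

## What this file records (design `class-closure/eng-4/b24i2/DESIGN-B24-IMPL2-v0.md` §(2)(g))

Setting: a dual pair of isogenies `φ : W → W′`, `ψ : W′ → W` of elliptic curves over a number
field with `ψ ∘ φ = [deg φ]` (for the instrument: `W = W₀`, `W′ = Ê`, `deg φ = 3`, `ψ = φ̂`), and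
the induced maps `Ш(φ) : Ш(W) → Ш(W′)`, `Ш(ψ) : Ш(W′) → Ш(W)` of the tree
(`Literature.NumberTheory.EllipticCurves.shaMap`, file `ShaIsogeny`), so that
`Ш(ψ) ∘ Ш(φ) = deg φ` (`shaMap_shaMap_eq_nsmul`) and `Ш(W′)[ψ] := ker Ш(ψ)`.

Implementation 1 of instrument B-24 (`ctp3iso`, cc-eng-5) VALUES the Cassels–Tate pairing on
`Ш(W′)[ψ]` (through `S^(ψ)(W′/ℚ)` modulo the Mordell–Weil image) and reads NON-DEGENERATE; its
kernel consumer is `X1/CasselsTateIsogenyCertificate.lean` (adjointness of the pairings, Milne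
*ADT* I Rem. 6.10(a)). Implementation 2 (`phisel3`, this seat) forms NO pairing: for each class
`x ∈ Ш(W′)[ψ]` (a `ψ`-covering `C_x → W` of `W`, a torsor under `W′`, written as a plane cubic —
Cohen–Pazuki, Acta Arith. 140 (2009) Thms. 3.1 / 4.1) it computes the `φ`-Selmer SET
`Sel^(φ)(C_x/ℚ)` by Creutz–Miller's second `φ`-descent (J. Algebra 372 (2012) Thm. 6.2) and reports
`EMPTY` / `NONEMPTY(witness)`; by Creutz–Miller's Lemma 2.3 ("for a `k`-torsor `C` under `E′`,
`C ∈ φШ(E/k) ⟺ Sel^(φ)(C/k) ≠ ∅`", a diagram chase) the verdict `EMPTY` on `x` says EXACTLY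
`x ∉ Ш(φ)(Ш(W))`, and the row verdict NONDEG₂ = "every non-trivial class of `Ш(W′)[ψ]` is `EMPTY`"
says `ker Ш(ψ) ⊓ range Ш(φ) = 0`. This file proves what that certificate yields, with NO pairing:

* §1 (pure algebra; `Φ : A →+ B`, `Ψ : B →+ A`, `Ψ ∘ Φ = n`): `ker Ψ ⊓ range Φ = Φ(A[n])`
  (the NONEMPTY non-trivial classes are exactly the images of `A[n]`); if `Φ` is injective and
  `ker Ψ ⊓ range Φ = 0` then `A[n] = 0`, and conversely (no injectivity) — so, granted `A[Φ] = 0`,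
  the certificate decides `A[n] = 0` EXACTLY; under injectivity `#(ker Ψ ⊓ range Φ) = #A[n]` (the
  DEG₂(k) reading) and ALL classes NONEMPTY ⇒ `#A[n] = #ker Ψ` (the C-ZERO control shape); for
  ANY bi-additive pairings making `Φ`, `Ψ` adjoint, `range Φ` is orthogonal to `ker Ψ`, hence
  implementation 1's certificate (non-degeneracy on `ker Ψ`) IMPLIES implementation 2's (the
  provable direction `kernel₂ ⊆ kernel₁` of the two-engine AGREE cross-read; equality is Fisher,
  J. Number Theory 98 (2003) Thm. 3, not used).
* §2 (`Ш` over a number field, the dual pair `(φ, ψ)`): the same statements for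
  `Φ = Ш(φ)`, `Ψ = Ш(ψ)`, `n = deg φ`: `sha_ker_inf_range_eq_map_torsionBy`,
  **`sha_torsion_eq_zero_of_shaMap_injective_of_phiCoverings_empty`** (`Ш(W)[φ] = 0` and the
  `phisel3` certificate ⇒ `Ш(W)[deg φ] = 0`), its converse and `iff`, the two counts, and
  `phiCoverings_empty_of_casselsTate_nondegenerate` (implementation 1 ⇒ implementation 2; with it
  X1's `sha_torsion_eq_zero_of_adjoint_of_nondegenerate` factors through this file).
* §3 (over `ℚ`, class-free END): **`bsdp_of_shaMap_injective_of_phiCoverings_empty`** —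
  `r_an(W) ≤ 1`, `p ∤ #Ш_an(W)`, `deg φ = p`, `Ш(φ)` injective, certificate ⇒ `BSDp W p`
  (Gross–Zagier–Kolyvagin only: `Typed.bsdp_of_shaAn_unit_of_noPTorsion`), and
  `bsdp_pair_of_shaMap_injective_of_phiCoverings_empty` — also `BSDp W′ p` (Cassels' isogeny
  invariance at `r_an ≤ 1`, `bsdp_iff_of_isIsogenous`; binders `hmod`, `hCassels`). For the
  instrument's universe (o6-r1's T-O6-CTP3 U1 rows: `W₀` the `3`-adic-unit member, `Ê = W₀/⟨T⟩`
  with `9 ∣ #Ш_an(Ê)`) this is the END `BSD(W₀, 3) ∧ BSD(Ê, 3)` per row, from PUBLISHED facts +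
  the two finite certificate lines (`Ш(W₀)[φ] = 0` first descent, two-engine; NONDEG₂ second
  `φ`-descent, EXACT label) — per PAIR, never a class.

The dictionary "`EMPTY` on the cubic `C_x` ⟺ `x ∉ range Ш(φ)`" (Creutz–Miller Lemma 2.3) and
"`S^(ψ)(W′/ℚ)/δ_ψ(W(ℚ)) ≅ Ш(W′)[ψ]`" (Silverman *AEC* X.4.2) is PRINTED and cited, not restated,
exactly as in `X1/CasselsTateIsogenyCertificate.lean`. The production mode of record `LINES = all`
(every class tested) is what `hcert` transcribes; the cheaper `LINES = one` mode would also need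
Cassels' squareness of `#Ш(W′)[ψ]/Ш(φ)(Ш(W)[p])` (Creutz–Miller Rem. 2.4) and is NOT served here.

References (context only): Creutz–Miller, J. Algebra 372 (2012), Lemma 2.3, Rem. 2.4, Thm. 6.2;
Cohen–Pazuki, Acta Arith. 140 (2009); van Beek–Fisher, Acta Arith. 185 (2018) (implementation 1);
Milne, *ADT* I Lemma 7.1(b), Rem. 6.10(a), Thm. 7.3 [MilneADT2006]; Miller, LMS J. Comput. Math.
14 (2011) Def. 1.1 [Miller2011LMS]; cell files `b24i2/DESIGN-B24-IMPL2-v0.md` §(2)(g),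
`b24i2/stage/STEP1-PREREG.md`, run of record kit j209300 (`phisel3-step1`, P-cc-21).
-/

set_option autoImplicit false

noncomputable section

open scoped Classical

open WeierstrassCurve Literature.NumberTheory.EllipticCurves
  Literature.NumberTheory.EllipticCurves.Rank1Residual

universe u

namespace Summit.BirchSwinnertonDyer.Rank1Residual.SecondDescent.PhiCovering

/-! ### §1 Pure algebra: a pair of homomorphisms `Φ : A → B`, `Ψ : B → A` with `Ψ ∘ Φ = n` -/

section Algebra

variable {A B : Type*} [AddCommGroup A] [AddCommGroup B] (Φ : A →+ B) (Ψ : B →+ A) {n : ℕ}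

/-- **The NONEMPTY non-trivial classes are the images of the `n`-torsion.** For homomorphisms
`Φ : A → B`, `Ψ : B → A` of additive groups with `Ψ (Φ a) = n • a`: `ker Ψ ⊓ range Φ = Φ(A[n])`
(for `Φ = Ш(φ)`, `Ψ = Ш(φ̂)`: the classes of `Ш(W′)[φ̂]` in `φШ(W)` are `Ш(φ)(Ш(W)[deg φ])`). -/
theorem ker_inf_range_eq_map_torsionBy (hΨΦ : ∀ a, Ψ (Φ a) = n • a) :
    Ψ.ker ⊓ Φ.range = (AddSubgroup.torsionBy A (n : ℤ)).map Φ := by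
  ext x
  simp only [AddSubgroup.mem_inf, AddMonoidHom.mem_ker, AddMonoidHom.mem_range,
    AddSubgroup.mem_map]
  constructor
  · rintro ⟨hx, a, rfl⟩
    refine ⟨a, ?_, rfl⟩
    rw [AddSubgroup.torsionBy.nsmul_iff, ← hΨΦ a]
    exact hx
  · rintro ⟨a, ha, rfl⟩
    refine ⟨?_, a, rfl⟩
    rw [hΨΦ a]
    exact AddSubgroup.torsionBy.nsmul_iff.mp ha

/-- **The second-descent certificate kills the `n`-torsion.** If `Ψ (Φ a) = n • a`, `Φ` is
injective (`A[Φ] = 0`, the first-descent datum) and NO non-zero element of `ker Ψ` lies in the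
image of `Φ` (the certificate: every non-trivial class has an EMPTY `Φ`-Selmer set), then `A` has
no non-zero element killed by `n` (`x := Φ a` has `Ψ x = n • a = 0`, so `x = 0`, so `a = 0`). -/
theorem forall_nsmul_eq_zero_of_injective_of_ker_inf_range (hΨΦ : ∀ a, Ψ (Φ a) = n • a)
    (hinj : ∀ a, Φ a = 0 → a = 0) (hcert : ∀ x, Ψ x = 0 → (∃ a, Φ a = x) → x = 0) :
    ∀ a : A, n • a = 0 → a = 0 := by
  intro a ha
  refine hinj a (hcert (Φ a) ?_ ⟨a, rfl⟩)
  rw [hΨΦ a, ha]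

/-- **Converse (sharpness of the certificate; no injectivity needed).** If `A[n] = 0` then no
non-zero element of `ker Ψ` lies in `range Φ`: for `x = Φ a` with `Ψ x = 0`, `n • a = Ψ (Φ a) = 0`,
so `a = 0` and `x = 0`. Hence, granted `A[Φ] = 0`, the second `Φ`-descent on the classes of
`ker Ψ` decides `A[n] = 0` EXACTLY (`phiCoverings_empty_iff_sha_torsion_eq_zero` below). -/
theorem ker_inf_range_trivial_of_forall_nsmul_eq_zero (hΨΦ : ∀ a, Ψ (Φ a) = n • a)
    (h : ∀ a : A, n • a = 0 → a = 0) : ∀ x, Ψ x = 0 → (∃ a, Φ a = x) → x = 0 := by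
  rintro x hx ⟨a, rfl⟩
  have ha : a = 0 := h a (by rw [← hΨΦ a]; exact hx)
  rw [ha, map_zero]

/-- **The DEG₂(k) reading: under injectivity, `#(ker Ψ ⊓ range Φ) = #A[n]`.** (For the
instrument: the number of NONEMPTY classes of `Ш(W′)[φ̂]` — the subgroup `kernel₂/MW` — equals
`#Ш(W)[deg φ]` when `Ш(W)[φ] = 0`; NONDEG₂ is the case `k = 0`.) -/
theorem natCard_ker_inf_range_eq_natCard_torsionBy (hΨΦ : ∀ a, Ψ (Φ a) = n • a)
    (hinj : Function.Injective Φ) :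
    Nat.card ↥(Ψ.ker ⊓ Φ.range) = Nat.card (AddSubgroup.torsionBy A (n : ℤ)) := by
  rw [ker_inf_range_eq_map_torsionBy Φ Ψ hΨΦ]
  exact AddSubgroup.card_map_of_injective hinj

/-- **The C-ZERO control shape: ALL classes NONEMPTY.** If `Φ` is injective and every element of
`ker Ψ` lies in `range Φ` (every class of `Ш(W′)[φ̂]` has a NONEMPTY `φ`-Selmer set), then
`#A[n] = #ker Ψ` (for the instrument: `#Ш(W)[3] = #Ш(W′)[φ̂]`, e.g. `= 9` on the cell's
BSD-forced control rows). -/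
theorem natCard_torsionBy_eq_natCard_ker_of_ker_le_range (hΨΦ : ∀ a, Ψ (Φ a) = n • a)
    (hinj : Function.Injective Φ) (hall : ∀ x, Ψ x = 0 → ∃ a, Φ a = x) :
    Nat.card (AddSubgroup.torsionBy A (n : ℤ)) = Nat.card Ψ.ker := by
  have hle : Ψ.ker ≤ Φ.range := fun x hx ↦ by
    rw [AddMonoidHom.mem_range]
    exact hall x (by rwa [AddMonoidHom.mem_ker] at hx)
  rw [← natCard_ker_inf_range_eq_natCard_torsionBy Φ Ψ hΨΦ hinj, inf_eq_left.mpr hle]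

variable {C : Type*} [AddCommGroup C]

/-- **Adjointness puts `range Φ` in the kernel of the pairing on `ker Ψ`.** For ANY bi-additive
pairings `P` on `A`, `P′` on `B` with `P′ (Φ a) b = P a (Ψ b)` (Cassels–Tate along a dual pair:
Milne *ADT* I Rem. 6.10(a)): `P′ (Φ a) y = P a (Ψ y) = 0` for `y ∈ ker Ψ` — the provable direction
`kernel₂ ⊆ kernel₁` of the two-engine cross-read (equality is Fisher 2003 Thm. 3, not used). -/
theorem ker_inf_range_orthogonal_of_adjoint (P : A →+ A →+ C) (P' : B →+ B →+ C)
    (hadj : ∀ a b, P' (Φ a) b = P a (Ψ b)) :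
    ∀ x, (∃ a, Φ a = x) → ∀ y, Ψ y = 0 → P' x y = 0 := by
  rintro x ⟨a, rfl⟩ y hy
  rw [hadj, hy, map_zero]

/-- **Implementation 1's certificate implies implementation 2's.** With `P`, `P′` adjoint, if
`P′` restricted to `ker Ψ` is NON-DEGENERATE (the `ctp3iso` verdict NONDEG) then no non-zero
element of `ker Ψ` lies in `range Φ` (the `phisel3` verdict NONDEG₂). -/
theorem ker_inf_range_trivial_of_adjoint_of_nondegenerate (P : A →+ A →+ C) (P' : B →+ B →+ C)
    (hadj : ∀ a b, P' (Φ a) b = P a (Ψ b))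
    (hND : ∀ x, Ψ x = 0 → (∀ y, Ψ y = 0 → P' x y = 0) → x = 0) :
    ∀ x, Ψ x = 0 → (∃ a, Φ a = x) → x = 0 :=
  fun x hx hxr ↦ hND x hx (ker_inf_range_orthogonal_of_adjoint Φ Ψ P P' hadj x hxr)

end Algebra

/-! ### §2 `Ш` along a dual pair of isogenies over a number field -/

section Sha

variable {K : Type u} [Field K] [NumberField K] {W W' : WeierstrassCurve K}

/-- **`ker Ш(ψ) ⊓ range Ш(φ) = Ш(φ)(Ш(W)[deg φ])`** for a dual pair `ψ ∘ φ = [deg φ]` of isogenies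
over a number field (`Ш(ψ) ∘ Ш(φ) = deg φ`, `shaMap_shaMap_eq_nsmul`): the classes of `Ш(Ê)[φ̂]`
whose covering has a NONEMPTY `φ`-Selmer set (Creutz–Miller Lemma 2.3: those in `φШ(W₀)`) are
exactly `φ(Ш(W₀)[3])`. [cite: MilneADT2006, Ch. I Lemma 7.1(b) (proof), p. 96] -/
theorem sha_ker_inf_range_eq_map_torsionBy (φ : Isogeny W W') (ψ : Isogeny W' W)
    (hψφ : ∀ P : W.geomPoints, ψ (φ P) = (φ.degree : ℤ) • P) :
    (shaMap ψ.toAddMonoidHom ψ.equivariant ψ.hasLocalPointsMaps_toAddMonoidHom).ker ⊓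
        (shaMap φ.toAddMonoidHom φ.equivariant φ.hasLocalPointsMaps_toAddMonoidHom).range =
      (AddSubgroup.torsionBy W.sha (φ.degree : ℤ)).map
        (shaMap φ.toAddMonoidHom φ.equivariant φ.hasLocalPointsMaps_toAddMonoidHom) :=
  ker_inf_range_eq_map_torsionBy _ _ (Isogeny.shaMap_shaMap_eq_nsmul φ ψ hψφ)

/-- **`Ш(W)[deg φ] = 0` from `Ш(W)[φ] = 0` and the second `φ`-descent certificate — no pairing.**
Let `φ : W → W′`, `ψ : W′ → W` be a dual pair of isogenies over a number field (`ψ ∘ φ = [deg φ]`).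
If `Ш(φ) : Ш(W) → Ш(W′)` is injective (first-descent datum `Ш(W)[φ] = 0`) and no non-zero class
of `Ш(W′)[ψ] = ker Ш(ψ)` lies in the image of `Ш(φ)` (the `phisel3` row verdict NONDEG₂: by
Creutz–Miller, J. Algebra 372 (2012) Lemma 2.3, a class `x` lies in `φШ(W)` iff the `φ`-Selmer
set of the corresponding covering is non-empty, and the engine finds every non-trivial one EMPTY),
then `Ш(W)` has no non-zero element killed by `deg φ` (for `(deg φ) • z = 0`, `Ш(φ) z` lies in
`ker Ш(ψ) ⊓ range Ш(φ)`, so it is `0`, so `z = 0`). Certificate-shaped hypotheses; nothing about any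
particular curve is asserted. [cite: MilneADT2006, Ch. I Lemma 7.1(b) (proof), p. 96] -/
theorem sha_torsion_eq_zero_of_shaMap_injective_of_phiCoverings_empty (φ : Isogeny W W')
    (ψ : Isogeny W' W) (hψφ : ∀ P : W.geomPoints, ψ (φ P) = (φ.degree : ℤ) • P)
    (hinj : ∀ z : W.sha,
      shaMap φ.toAddMonoidHom φ.equivariant φ.hasLocalPointsMaps_toAddMonoidHom z = 0 → z = 0)
    (hcert : ∀ x : W'.sha,
      shaMap ψ.toAddMonoidHom ψ.equivariant ψ.hasLocalPointsMaps_toAddMonoidHom x = 0 →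
        (∃ z : W.sha,
          shaMap φ.toAddMonoidHom φ.equivariant φ.hasLocalPointsMaps_toAddMonoidHom z = x) →
        x = 0) :
    ∀ z : W.sha, (φ.degree : ℤ) • z = 0 → z = 0 := by
  intro z hz
  have hz' : φ.degree • z = 0 := by rwa [← natCast_zsmul]
  exact forall_nsmul_eq_zero_of_injective_of_ker_inf_range _ _
    (Isogeny.shaMap_shaMap_eq_nsmul φ ψ hψφ) hinj hcert z hz'

/-- **Sharpness: if `Ш(W)[deg φ] = 0` then the certificate holds** (no non-zero class of
`Ш(W′)[ψ]` lies in `range Ш(φ)`; no injectivity needed). So on a row with `Ш(W₀)[φ] = 0` the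
second `φ`-descent verdict NONDEG₂ is EQUIVALENT to `Ш(W₀)[3] = 0`
(`phiCoverings_empty_iff_sha_torsion_eq_zero`): a DEG₂ verdict there exhibits `Ш(W₀)[3] ≠ 0`.
[cite: MilneADT2006, Ch. I Lemma 7.1(b) (proof), p. 96] -/
theorem phiCoverings_empty_of_sha_torsion_eq_zero (φ : Isogeny W W') (ψ : Isogeny W' W)
    (hψφ : ∀ P : W.geomPoints, ψ (φ P) = (φ.degree : ℤ) • P)
    (h : ∀ z : W.sha, (φ.degree : ℤ) • z = 0 → z = 0) :
    ∀ x : W'.sha,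
      shaMap ψ.toAddMonoidHom ψ.equivariant ψ.hasLocalPointsMaps_toAddMonoidHom x = 0 →
        (∃ z : W.sha,
          shaMap φ.toAddMonoidHom φ.equivariant φ.hasLocalPointsMaps_toAddMonoidHom z = x) →
        x = 0 := by
  refine ker_inf_range_trivial_of_forall_nsmul_eq_zero _ _
    (Isogeny.shaMap_shaMap_eq_nsmul φ ψ hψφ) fun z hz ↦ h z ?_
  rwa [natCast_zsmul]

/-- **Granted `Ш(W)[φ] = 0`, the second `φ`-descent certificate is EQUIVALENT to
`Ш(W)[deg φ] = 0`.** [cite: MilneADT2006, Ch. I Lemma 7.1(b) (proof), p. 96] -/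
theorem phiCoverings_empty_iff_sha_torsion_eq_zero (φ : Isogeny W W') (ψ : Isogeny W' W)
    (hψφ : ∀ P : W.geomPoints, ψ (φ P) = (φ.degree : ℤ) • P)
    (hinj : ∀ z : W.sha,
      shaMap φ.toAddMonoidHom φ.equivariant φ.hasLocalPointsMaps_toAddMonoidHom z = 0 → z = 0) :
    (∀ x : W'.sha,
      shaMap ψ.toAddMonoidHom ψ.equivariant ψ.hasLocalPointsMaps_toAddMonoidHom x = 0 →
        (∃ z : W.sha,
          shaMap φ.toAddMonoidHom φ.equivariant φ.hasLocalPointsMaps_toAddMonoidHom z = x) →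
        x = 0) ↔
      ∀ z : W.sha, (φ.degree : ℤ) • z = 0 → z = 0 :=
  ⟨sha_torsion_eq_zero_of_shaMap_injective_of_phiCoverings_empty φ ψ hψφ hinj,
    phiCoverings_empty_of_sha_torsion_eq_zero φ ψ hψφ⟩

/-- **The DEG₂(k) reading on `Ш`: under `Ш(W)[φ] = 0`, `#(ker Ш(ψ) ⊓ range Ш(φ)) = #Ш(W)[deg φ]`**
(`Nat.card`; so a count `3^k` of NONEMPTY classes modulo Mordell–Weil IS `#Ш(W₀)[3] = 3^k`).
[cite: MilneADT2006, Ch. I Lemma 7.1(b) (proof), p. 96] -/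
theorem natCard_sha_ker_inf_range_eq (φ : Isogeny W W') (ψ : Isogeny W' W)
    (hψφ : ∀ P : W.geomPoints, ψ (φ P) = (φ.degree : ℤ) • P)
    (hinj : Function.Injective
      (shaMap φ.toAddMonoidHom φ.equivariant φ.hasLocalPointsMaps_toAddMonoidHom)) :
    Nat.card ↥((shaMap ψ.toAddMonoidHom ψ.equivariant ψ.hasLocalPointsMaps_toAddMonoidHom).ker ⊓
        (shaMap φ.toAddMonoidHom φ.equivariant φ.hasLocalPointsMaps_toAddMonoidHom).range) =
      Nat.card (AddSubgroup.torsionBy W.sha (φ.degree : ℤ)) :=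
  natCard_ker_inf_range_eq_natCard_torsionBy _ _ (Isogeny.shaMap_shaMap_eq_nsmul φ ψ hψφ) hinj

/-- **The C-ZERO control shape on `Ш`: ALL classes NONEMPTY and `Ш(W)[φ] = 0` give
`#Ш(W)[deg φ] = #Ш(W′)[ψ]`** (e.g. `= 9` on the cell's BSD-forced control rows, where both first
descents read `dim Ш(Ê)[φ̂] = 2`). [cite: MilneADT2006, Ch. I Lemma 7.1(b) (proof), p. 96] -/
theorem natCard_sha_torsionBy_eq_natCard_ker_of_phiCoverings_nonempty (φ : Isogeny W W')
    (ψ : Isogeny W' W) (hψφ : ∀ P : W.geomPoints, ψ (φ P) = (φ.degree : ℤ) • P)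
    (hinj : Function.Injective
      (shaMap φ.toAddMonoidHom φ.equivariant φ.hasLocalPointsMaps_toAddMonoidHom))
    (hall : ∀ x : W'.sha,
      shaMap ψ.toAddMonoidHom ψ.equivariant ψ.hasLocalPointsMaps_toAddMonoidHom x = 0 →
        ∃ z : W.sha,
          shaMap φ.toAddMonoidHom φ.equivariant φ.hasLocalPointsMaps_toAddMonoidHom z = x) :
    Nat.card (AddSubgroup.torsionBy W.sha (φ.degree : ℤ)) =
      Nat.card (shaMap ψ.toAddMonoidHom ψ.equivariant ψ.hasLocalPointsMaps_toAddMonoidHom).ker :=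
  natCard_torsionBy_eq_natCard_ker_of_ker_le_range _ _ (Isogeny.shaMap_shaMap_eq_nsmul φ ψ hψφ)
    hinj hall

/-- **Implementation 1 ⇒ implementation 2 on `Ш`.** For bi-additive pairings `B` on `Ш(W)` and
`B′` on `Ш(W′)` making `Ш(φ)`, `Ш(ψ)` adjoint (`B′ (Ш(φ) a) b = B a (Ш(ψ) b)` — the Cassels–Tate
pairings: Milne *ADT* I Rem. 6.10(a), the tree's `exists_casselsTate_pairing_adjoint`), the
`ctp3iso` certificate "`B′` NON-DEGENERATE on `Ш(W′)[ψ]`" implies the `phisel3` certificate "no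
non-zero class of `Ш(W′)[ψ]` in `range Ш(φ)`"; composed with the previous theorem this re-derives
X1's `sha_torsion_eq_zero_of_adjoint_of_nondegenerate`.
[cite: MilneADT2006, Ch. I Remark 6.10(a)] -/
theorem phiCoverings_empty_of_casselsTate_nondegenerate (φ : Isogeny W W') (ψ : Isogeny W' W)
    (B : W.sha →+ W.sha →+ AddCircle (1 : ℚ)) (B' : W'.sha →+ W'.sha →+ AddCircle (1 : ℚ))
    (hadj : ∀ a b,
      B' (shaMap φ.toAddMonoidHom φ.equivariant φ.hasLocalPointsMaps_toAddMonoidHom a) b =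
        B a (shaMap ψ.toAddMonoidHom ψ.equivariant ψ.hasLocalPointsMaps_toAddMonoidHom b))
    (hND : ∀ x : W'.sha,
      shaMap ψ.toAddMonoidHom ψ.equivariant ψ.hasLocalPointsMaps_toAddMonoidHom x = 0 →
        (∀ y : W'.sha,
          shaMap ψ.toAddMonoidHom ψ.equivariant ψ.hasLocalPointsMaps_toAddMonoidHom y = 0 →
            B' x y = 0) → x = 0) :
    ∀ x : W'.sha,
      shaMap ψ.toAddMonoidHom ψ.equivariant ψ.hasLocalPointsMaps_toAddMonoidHom x = 0 →
        (∃ z : W.sha,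
          shaMap φ.toAddMonoidHom φ.equivariant φ.hasLocalPointsMaps_toAddMonoidHom z = x) →
        x = 0 :=
  ker_inf_range_trivial_of_adjoint_of_nondegenerate _ _ B B' hadj hND

/-- **The C-ZERO / DEG₂ direction: a NONEMPTY non-trivial class exhibits `Ш(W)[p] ≠ 0`.**
If some non-zero class of `Ш(W′)[ψ]` lies in `range Ш(φ)` (a `NONEMPTY(witness)` verdict on a
non-Mordell–Weil line) then `Ш(W)` HAS a non-zero element killed by `deg φ` (no injectivity
needed) — the anomaly-protocol shape: on a row with `p ∤ #Ш_an(W)` such a witness contradicts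
`BSD(W,p)` given GZK; reported, never booked.
[cite: MilneADT2006, Ch. I Lemma 7.1(b) (proof), p. 96] -/
theorem exists_sha_torsion_ne_zero_of_phiCovering_nonempty (φ : Isogeny W W') (ψ : Isogeny W' W)
    (hψφ : ∀ P : W.geomPoints, ψ (φ P) = (φ.degree : ℤ) • P) {x : W'.sha} (hx0 : x ≠ 0)
    (hx : shaMap ψ.toAddMonoidHom ψ.equivariant ψ.hasLocalPointsMaps_toAddMonoidHom x = 0)
    (hxr : ∃ z : W.sha,
      shaMap φ.toAddMonoidHom φ.equivariant φ.hasLocalPointsMaps_toAddMonoidHom z = x) :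
    ∃ z : W.sha, z ≠ 0 ∧ (φ.degree : ℤ) • z = 0 := by
  by_contra h
  refine hx0 (phiCoverings_empty_of_sha_torsion_eq_zero φ ψ hψφ (fun z hz ↦ ?_) x hx hxr)
  by_contra hz0
  exact h ⟨z, hz0, hz⟩

end Sha

/-! ### §3 The class-free END over `ℚ` -/

section Rat

variable {W W' : WeierstrassCurve ℚ}

/-- **`BSD(W, p)` from `Ш(W)[φ] = 0` and the second `φ`-descent certificate (class-free,
Cassels–Tate-free).** For an elliptic `W/ℚ` with `r_an(W) ≤ 1` and `p ∤ #Ш_an(W)`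
(`#Ш_an(W) = q`, `ord_p q = 0`), a dual pair `φ : W → W′`, `ψ : W′ → W` with `deg φ = p`
(`ψ ∘ φ = [p]`), the first-descent datum "`Ш(φ)` injective" and the second-descent certificate
"no non-zero class of `Ш(W′)[ψ]` lies in `range Ш(φ)`" (every non-trivial `ψ`-covering has an
EMPTY `φ`-Selmer set, Creutz–Miller Lemma 2.3 / Thm. 6.2): `Ш(W)[p] = 0`
(`sha_torsion_eq_zero_of_shaMap_injective_of_phiCoverings_empty`), whence `BSDp W p` by
`Typed.bsdp_of_shaAn_unit_of_noPTorsion` (Gross–Zagier–Kolyvagin `hGZK` only). For the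
instrument's rows: `W = W₀` the `3`-adic-unit member of a `3`-isogeny class, `p = 3`. PUBLISHED
inputs + a per-pair certificate; not a class theorem; no reduction-type hypothesis.
[cite: Miller2011LMS, §1 Def. 1.1] [cite: MilneADT2006, Ch. I Lemma 7.1(b) (proof), p. 96] -/
theorem bsdp_of_shaMap_injective_of_phiCoverings_empty
    (hGZK : rank_eq_analyticRank_of_analyticRank_le_one)
    (W W' : WeierstrassCurve ℚ) [W.IsElliptic] [W'.IsElliptic]
    (p : ℕ) [Fact p.Prime] (hr : W.analyticRank ≤ 1)
    {q : ℚ} (hq : shaAn W = (q : ℂ)) (hv : padicValRat p q = 0)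
    (φ : Isogeny W W') (ψ : Isogeny W' W)
    (hψφ : ∀ P : W.geomPoints, ψ (φ P) = (φ.degree : ℤ) • P) (hdeg : φ.degree = p)
    (hinj : ∀ z : W.sha,
      shaMap φ.toAddMonoidHom φ.equivariant φ.hasLocalPointsMaps_toAddMonoidHom z = 0 → z = 0)
    (hcert : ∀ x : W'.sha,
      shaMap ψ.toAddMonoidHom ψ.equivariant ψ.hasLocalPointsMaps_toAddMonoidHom x = 0 →
        (∃ z : W.sha,
          shaMap φ.toAddMonoidHom φ.equivariant φ.hasLocalPointsMaps_toAddMonoidHom z = x) →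
        x = 0) :
    BSDp W p := by
  refine Typed.bsdp_of_shaAn_unit_of_noPTorsion W p hGZK hr hq hv ?_
  intro x hx
  refine sha_torsion_eq_zero_of_shaMap_injective_of_phiCoverings_empty φ ψ hψφ hinj hcert x ?_
  rwa [hdeg]

/-- **Both curves of the pair.** Under the hypotheses of
`bsdp_of_shaMap_injective_of_phiCoverings_empty`, with `W` and `W′` globally minimal, also
`BSDp W′ p` — Cassels' isogeny invariance of the BSD quotient at analytic rank `≤ 1`
(`bsdp_iff_of_isIsogenous`; binders `hmod` modularity, `hCassels` Cassels 1965 / Milne *ADT*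
I.7.3). For the instrument's U1 rows this reads `BSD(W₀, 3) ∧ BSD(Ê, 3)` with `9 ∣ #Ш_an(Ê)`: the
`3`-part of `#Ш(Ê)` is reached through the unit member, never by a descent on `Ê` itself.
[cite: MilneADT2006, Ch. I Thm. 7.3] [cite: Miller2011LMS, §1 Def. 1.1] -/
theorem bsdp_pair_of_shaMap_injective_of_phiCoverings_empty
    (hGZK : rank_eq_analyticRank_of_analyticRank_le_one)
    (hmod : hasEntireLFunction_rat) (hCassels : bsdRHS_eq_of_isIsogenous)
    (W W' : WeierstrassCurve ℚ) [W.IsElliptic] [W'.IsElliptic] [W.IsGloballyMinimal]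
    [W'.IsGloballyMinimal] (p : ℕ) [Fact p.Prime] (hr : W.analyticRank ≤ 1)
    {q : ℚ} (hq : shaAn W = (q : ℂ)) (hv : padicValRat p q = 0)
    (φ : Isogeny W W') (ψ : Isogeny W' W)
    (hψφ : ∀ P : W.geomPoints, ψ (φ P) = (φ.degree : ℤ) • P) (hdeg : φ.degree = p)
    (hinj : ∀ z : W.sha,
      shaMap φ.toAddMonoidHom φ.equivariant φ.hasLocalPointsMaps_toAddMonoidHom z = 0 → z = 0)
    (hcert : ∀ x : W'.sha,
      shaMap ψ.toAddMonoidHom ψ.equivariant ψ.hasLocalPointsMaps_toAddMonoidHom x = 0 →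
        (∃ z : W.sha,
          shaMap φ.toAddMonoidHom φ.equivariant φ.hasLocalPointsMaps_toAddMonoidHom z = x) →
        x = 0) :
    BSDp W p ∧ BSDp W' p := by
  have hB : BSDp W p := bsdp_of_shaMap_injective_of_phiCoverings_empty hGZK W W' p hr hq hv φ ψ
    hψφ hdeg hinj hcert
  refine ⟨hB, ?_⟩
  have hiso : IsIsogenous W W' := ⟨φ⟩
  exact (BirchSwinnertonDyer.Theorems.Rank1ResidualX1Isogeny.bsdp_iff_of_isIsogenous hGZK hmod
    hCassels W W' hiso p hr).mp hB

end Rat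

end Summit.BirchSwinnertonDyer.Rank1Residual.SecondDescent.PhiCovering

end
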